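import Summits.AnomalousDissipation.AnomalousDissipation.Theorems.MomentParityMomentLadderStubUIResolution
import Summits.AnomalousDissipation.AnomalousDissipation.Theorems.MomentParityMomentLadderStubTailLePalinstrophy
import Summits.AnomalousDissipation.AnomalousDissipation.Theorems.CubicParityLoud.Negative.Clauses

/-!
# Stub `stub_resolvedOfTails` for line `enstrophy-ui-level-ledger`
# (crux `MomentParity.ResolvedDissipation`, stmt-AnomalousDissipation-14284)

The E1 transfer of the line, in the direction used: at fixed `(f, ν, R)`, IF the bounded-enstrophy
strata of every admissible law are resolved uniformly in the Galerkin level `N`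
(`∀ Λ ∃ C ∀ admissible (N, μ) : ∫_{Z ≤ Λ} ‖Δu‖² dμ ≤ C`) AND the enstrophy tails decay uniformly
(`∀ ε > 0 ∃ Λ ∀ admissible (N, μ) : ∫_{Z > Λ} Z dμ ≤ ε`), THEN one schedule `κ` resolves every
admissible law at every level: `∫ Z dμ ≤ ∫ Z(P_{κ n} u) dμ + (n+1)⁻¹` for all `n`.

Pure `ℝ≥0∞` bookkeeping (no fluid mechanics; the four admissibility clauses are only passed to the two
hypotheses). Pointwise, by the spectral gap `MomentLadder.stub_tailLePalinstrophy`
(`Z ≤ Z ∘ P_K + (4π²(K²+1))⁻¹ ‖Δu‖²`) on the stratum `{Z ≤ Λ}` and trivially off it,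
`Z ≤ Z ∘ P_K + (4π²(K²+1))⁻¹ · 1_{Z ≤ Λ} ‖Δu‖² + 1_{Λ < Z} Z`; integrate; for the `n`-th budget
`(n+1)⁻¹ = (n+1)⁻¹/2 + (n+1)⁻¹/2` choose the threshold `Λ n` of the tail hypothesis at `(n+1)⁻¹/2`, the
stratum constant `C n = C(Λ n)`, and the cutoff `κ n` with `(4π²(κ n² + 1))⁻¹ C n ≤ (n+1)⁻¹/2`
(`MomentLadder.exists_tailCoeff_mul_le`). Template: `MomentLadder.stub_uiResolution`
(Theorems/MomentParityMomentLadderStubUIResolution.lean), with strata in place of the FGT weight.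
-/

noncomputable section

-- `Summit.<Summit>.<Problem>`: single-conjunct summit, the duplicate namespace segment is mandated.
set_option linter.dupNamespace false

namespace Summit.AnomalousDissipation.AnomalousDissipation.Theorems.MomentParityResolvedDissipation.ResolvedOfTails

open MeasureTheory Filter Topology Set
open scoped ENNReal InnerProductSpace RealInnerProductSpace
open Literature.Analysis.FunctionSpaces Literature.Analysis.FluidPDE
open Summit.AnomalousDissipation.AnomalousDissipation.Theses.MomentParity
open Summit.AnomalousDissipation.AnomalousDissipation.Theorems.CubicParityLoud.Negative (T3 R3 H3)
open Summit.AnomalousDissipation.AnomalousDissipation.Theorems.QuarticGate.Negative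
  (IsLevel IsBandTest polyGrad IsPolyStationary)
open Summit.AnomalousDissipation.AnomalousDissipation.Theorems.MomentLadder
  (stub_tailLePalinstrophy exists_tailCoeff_mul_le measurable_eLaplacianNormSq_coe)

/-! ## The Chebyshev splitting over an enstrophy stratum -/

/-- Pointwise splitting at the enstrophy level `L ∈ [0, ∞]` with cutoff `K`: for every `u ∈ H`,
`Z u ≤ Z(P_K u) + (4π²(K²+1))⁻¹ · 1_{Z ≤ L}(u) ‖Δu‖² + 1_{L < Z}(u) Z u`. On the stratum `{Z ≤ L}`
this is the spectral gap `MomentLadder.stub_tailLePalinstrophy` (the representative of `u ∈ H ⊆ L²` is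
integrable on the finite-measure torus); off it the bound is trivial. [folklore] -/
theorem eGradNormSq_le_split_strata (K : ℕ) (L : ℝ≥0∞) (u : H3) :
    Torus.eGradNormSq (u.1 : T3 → R3) ≤
      Torus.eGradNormSq (Torus.fourierTruncate K (u.1 : T3 → R3)) +
        ((ENNReal.ofReal (4 * Real.pi ^ 2 * ((K : ℝ) ^ 2 + 1)))⁻¹ *
            {u : H3 | Torus.eGradNormSq (u.1 : T3 → R3) ≤ L}.indicator
              (fun u : H3 => eLaplacianNormSq (u.1 : T3 → R3)) u +
          {u : H3 | L < Torus.eGradNormSq (u.1 : T3 → R3)}.indicator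
            (fun u : H3 => Torus.eGradNormSq (u.1 : T3 → R3)) u) := by
  by_cases hu : L < Torus.eGradNormSq (u.1 : T3 → R3)
  · have hmem : u ∈ {u : H3 | L < Torus.eGradNormSq (u.1 : T3 → R3)} := hu
    rw [indicator_of_mem hmem]
    exact le_add_self.trans le_add_self
  · rw [not_lt] at hu
    have hmem : u ∈ {u : H3 | Torus.eGradNormSq (u.1 : T3 → R3) ≤ L} := hu
    rw [indicator_of_mem hmem]
    have hint : Integrable (u.1 : T3 → R3) volume := (Lp.memLp u.1).integrable one_le_two
    exact (stub_tailLePalinstrophy K _ hint).trans (add_le_add le_rfl le_self_add)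

/-- Integrated splitting at the enstrophy level `L ∈ [0, ∞]` with cutoff `K`: for every law `μ` on `H`,
`∫ Z dμ ≤ ∫ Z(P_K u) dμ + ((4π²(K²+1))⁻¹ ∫_{Z ≤ L} ‖Δu‖² dμ + ∫_{L < Z} Z dμ)`
(integrate `eGradNormSq_le_split_strata`; both densities are Borel measurable on `H`,
`Torus.measurable_eGradNormSq_coe`, `MomentLadder.measurable_eLaplacianNormSq_coe`). [folklore] -/
theorem lintegral_eGradNormSq_le_split_strata (K : ℕ) (L : ℝ≥0∞) (μ : Measure H3) :
    ∫⁻ u, Torus.eGradNormSq (u.1 : T3 → R3) ∂μ ≤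
      (∫⁻ u, Torus.eGradNormSq (Torus.fourierTruncate K (u.1 : T3 → R3)) ∂μ) +
        ((ENNReal.ofReal (4 * Real.pi ^ 2 * ((K : ℝ) ^ 2 + 1)))⁻¹ *
            ∫⁻ u in {u : H3 | Torus.eGradNormSq (u.1 : T3 → R3) ≤ L},
              eLaplacianNormSq (u.1 : T3 → R3) ∂μ +
          ∫⁻ u in {u : H3 | L < Torus.eGradNormSq (u.1 : T3 → R3)},
            Torus.eGradNormSq (u.1 : T3 → R3) ∂μ) := by
  set Z : H3 → ℝ≥0∞ := fun u => Torus.eGradNormSq (u.1 : T3 → R3) with hZ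
  set Pal : H3 → ℝ≥0∞ := fun u => eLaplacianNormSq (u.1 : T3 → R3) with hPal
  set c : ℝ≥0∞ := (ENNReal.ofReal (4 * Real.pi ^ 2 * ((K : ℝ) ^ 2 + 1)))⁻¹ with hc
  have hZm : Measurable Z := Torus.measurable_eGradNormSq_coe
  have hPalm : Measurable Pal := measurable_eLaplacianNormSq_coe
  have hS : MeasurableSet {u : H3 | Z u ≤ L} := measurableSet_le hZm measurable_const
  have hS' : MeasurableSet {u : H3 | L < Z u} := measurableSet_lt measurable_const hZm
  have hIPm : Measurable ({u : H3 | Z u ≤ L}.indicator Pal) := hPalm.indicator hS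
  have hWm : Measurable fun u => c * {u : H3 | Z u ≤ L}.indicator Pal u := hIPm.const_mul _
  have hIm : Measurable ({u : H3 | L < Z u}.indicator Z) := hZm.indicator hS'
  change ∫⁻ u, Z u ∂μ ≤ (∫⁻ u, Torus.eGradNormSq (Torus.fourierTruncate K (u.1 : T3 → R3)) ∂μ) +
    (c * ∫⁻ u in {u : H3 | Z u ≤ L}, Pal u ∂μ + ∫⁻ u in {u : H3 | L < Z u}, Z u ∂μ)
  calc ∫⁻ u, Z u ∂μ ≤ ∫⁻ u, Torus.eGradNormSq (Torus.fourierTruncate K (u.1 : T3 → R3)) +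
        (c * {u : H3 | Z u ≤ L}.indicator Pal u + {u : H3 | L < Z u}.indicator Z u) ∂μ :=
        lintegral_mono fun u => eGradNormSq_le_split_strata K L u
    _ = (∫⁻ u, Torus.eGradNormSq (Torus.fourierTruncate K (u.1 : T3 → R3)) ∂μ) +
        ∫⁻ u, (c * {u : H3 | Z u ≤ L}.indicator Pal u + {u : H3 | L < Z u}.indicator Z u) ∂μ :=
        lintegral_add_right _ (hWm.add hIm)
    _ = _ := by
        rw [lintegral_add_right _ hIm, lintegral_const_mul _ hIPm, lintegral_indicator hS,
          lintegral_indicator hS']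

/-! ## The stub -/

/-- **S3 · `stub_resolvedOfTails` (the E1 transfer, direction used).** At fixed `(f, ν, R)`: IF the
bounded-enstrophy strata are resolved uniformly in `N` (`∀ Λ ∃ C ∀ admissible (N, μ) :
∫_{Z ≤ Λ} ‖Δu‖² dμ ≤ C`) AND the enstrophy tails decay uniformly (`∀ ε > 0 ∃ Λ ∀ admissible (N, μ) :
∫_{Z > Λ} Z dμ ≤ ε`), THEN one schedule `κ` resolves every admissible law at every level. For the
`n`-th budget take the tail threshold `Λ n` at `(n+1)⁻¹/2`, the stratum constant `C n = C(Λ n)` and the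
cutoff `κ n` with `(4π²(κ n² + 1))⁻¹ C n ≤ (n+1)⁻¹/2` (`MomentLadder.exists_tailCoeff_mul_le`), then
integrate the stratum splitting `lintegral_eGradNormSq_le_split_strata`. [folklore; FMRT2001 IV §1] -/
theorem stub_resolvedOfTails :
    ∀ (f : T3 → R3) (ν R : ℝ),
    (∀ Λ : ℝ, ∃ C : ℝ, ∀ (N : ℕ) (μ : Measure H3), IsProbabilityMeasure μ →
      (∀ᵐ u ∂μ, IsLevel N u) → (∀ᵐ u ∂μ, ‖u‖ ≤ R) → (∀ d : ℕ, IsPolyStationary ν f N d μ) →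
      ∫⁻ u in {u : H3 | Torus.eGradNormSq (u.1 : T3 → R3) ≤ ENNReal.ofReal Λ},
          eLaplacianNormSq (u.1 : T3 → R3) ∂μ ≤ ENNReal.ofReal C) →
    (∀ ε : ℝ, 0 < ε → ∃ Λ : ℝ, ∀ (N : ℕ) (μ : Measure H3), IsProbabilityMeasure μ →
      (∀ᵐ u ∂μ, IsLevel N u) → (∀ᵐ u ∂μ, ‖u‖ ≤ R) → (∀ d : ℕ, IsPolyStationary ν f N d μ) →
      ∫⁻ u in {u : H3 | ENNReal.ofReal Λ < Torus.eGradNormSq (u.1 : T3 → R3)},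
          Torus.eGradNormSq (u.1 : T3 → R3) ∂μ ≤ ENNReal.ofReal ε) →
    ∃ κ : ℕ → ℕ, ∀ (N : ℕ) (μ : Measure H3), IsProbabilityMeasure μ →
      (∀ᵐ u ∂μ, IsLevel N u) → (∀ᵐ u ∂μ, ‖u‖ ≤ R) → (∀ d : ℕ, IsPolyStationary ν f N d μ) →
      ∀ n : ℕ, ∫⁻ u, Torus.eGradNormSq (u.1 : T3 → R3) ∂μ ≤
        (∫⁻ u, Torus.eGradNormSq (Torus.fourierTruncate (κ n) (u.1 : T3 → R3)) ∂μ) +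
          ((n : ℝ≥0∞) + 1)⁻¹ := by
  intro f ν R hStrata hTails
  -- the real half-budgets `δ n = (n+1)⁻¹/2 > 0` and their `ℝ≥0∞` counterparts `ε n`
  set δ : ℕ → ℝ := fun n => ((n : ℝ) + 1)⁻¹ / 2 with hδ
  have hδ0 : ∀ n, 0 < δ n := fun n => by
    rw [hδ]
    positivity
  set ε : ℕ → ℝ≥0∞ := fun n => ((n : ℝ≥0∞) + 1)⁻¹ / 2 with hε
  have hε0 : ∀ n, ε n ≠ 0 := fun n => by
    rw [hε]
    exact (ENNReal.div_pos_iff.2 ⟨ENNReal.inv_ne_zero.2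
      (ENNReal.add_ne_top.2 ⟨ENNReal.natCast_ne_top n, ENNReal.one_ne_top⟩), ENNReal.ofNat_ne_top⟩).ne'
  have hδε : ∀ n, ENNReal.ofReal (δ n) = ε n := fun n => by
    have hn : (0 : ℝ) < (n : ℝ) + 1 := by positivity
    rw [hδ, hε]
    dsimp only
    rw [ENNReal.ofReal_div_of_pos two_pos, ENNReal.ofReal_ofNat, ENNReal.ofReal_inv_of_pos hn,
      ENNReal.ofReal_add (Nat.cast_nonneg n) zero_le_one, ENNReal.ofReal_natCast, ENNReal.ofReal_one]
  -- the tail thresholds `Λ n` (tails `≤ δ n`) and the stratum constants `C n = C(Λ n)`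
  choose Λ hΛ using fun n => hTails (δ n) (hδ0 n)
  choose C hC using fun n => hStrata (Λ n)
  -- the cutoffs `κ n`: `(4π²(κ n² + 1))⁻¹ · C n ≤ ε n`
  have hK' : ∀ n, ∃ K : ℕ, (ENNReal.ofReal (4 * Real.pi ^ 2 * ((K : ℝ) ^ 2 + 1)))⁻¹ *
      ENNReal.ofReal (C n) ≤ ε n := fun n => exists_tailCoeff_mul_le ENNReal.ofReal_ne_top (hε0 n)
  choose κ hκ using hK'
  refine ⟨κ, fun N μ hP hL hB hS n => ?_⟩
  calc ∫⁻ u, Torus.eGradNormSq (u.1 : T3 → R3) ∂μ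
      ≤ (∫⁻ u, Torus.eGradNormSq (Torus.fourierTruncate (κ n) (u.1 : T3 → R3)) ∂μ) +
          ((ENNReal.ofReal (4 * Real.pi ^ 2 * ((κ n : ℝ) ^ 2 + 1)))⁻¹ *
              ∫⁻ u in {u : H3 | Torus.eGradNormSq (u.1 : T3 → R3) ≤ ENNReal.ofReal (Λ n)},
                eLaplacianNormSq (u.1 : T3 → R3) ∂μ +
            ∫⁻ u in {u : H3 | ENNReal.ofReal (Λ n) < Torus.eGradNormSq (u.1 : T3 → R3)},
              Torus.eGradNormSq (u.1 : T3 → R3) ∂μ) :=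
        lintegral_eGradNormSq_le_split_strata (κ n) (ENNReal.ofReal (Λ n)) μ
    _ ≤ (∫⁻ u, Torus.eGradNormSq (Torus.fourierTruncate (κ n) (u.1 : T3 → R3)) ∂μ) + (ε n + ε n) :=
        add_le_add le_rfl (add_le_add ((mul_le_mul' le_rfl (hC n N μ hP hL hB hS)).trans (hκ n))
          ((hΛ n N μ hP hL hB hS).trans (hδε n).le))
    _ = (∫⁻ u, Torus.eGradNormSq (Torus.fourierTruncate (κ n) (u.1 : T3 → R3)) ∂μ) +
          ((n : ℝ≥0∞) + 1)⁻¹ := by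
        rw [hε, ENNReal.add_halves]

end Summit.AnomalousDissipation.AnomalousDissipation.Theorems.MomentParityResolvedDissipation.ResolvedOfTails

end
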